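import Summits.MatrixMultiplication.MatrixMultiplication.Theorems.ObstructionCalculusLocality
import Summits.MatrixMultiplication.MatrixMultiplication.Theses.ObstructionDescent

/-!
# ObstructionDescent — rung R1 `FormatDegreeBlind` (item stmt-MatrixMultiplication-30920) PROVED

LANDING FORM (decomp-mm-lander-1 g1, 2026-08-30; REQUESTS #16-ii/iii, decomp-mm SUMMON Tier 3 (10)) of the rung-R1 section of the
lens-3 gen-8 kernel `DegreeFiltration_g8_tree.lean` (sha256 `132d565c…aec8`, 2383 lines; critic-CLEARED decomp-mm STATUS l.348/365):
the transport `formatDegreeBlind_iff` (source l.1628–1631) and the section «Rung R1 (kernel): equations of degree `≤ m` are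
blind» (source l.1705–1819: `eq_zero_of_totalDegree_le`, `formatDegreeBlind_holds`, `noPolyDegreeObstruction_row_one`,
`noPolyDegreeObstruction_one`), copied byte-identically.  The ONLY change is the one the writer asked for («use the ROUTE names»):
the source states these inside its vendored namespace `Theses.ObstructionDescent.Gen8`, whose `FormatDegreeBlind` is
byte-identical to the TREE declaration `Summit.MatrixMultiplication.MatrixMultiplication.Theses.ObstructionDescent.FormatDegreeBlind`
(route file rev 4; `example : Gen8.FormatDegreeBlind = FormatDegreeBlind := rfl` in the source, Part 5) — here the tree name is
opened instead, so `formatDegreeBlind_holds : FormatDegreeBlind` has LITERALLY the route decl as its type and no `Gen8` def lands.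
Imports the landed route-free calculus chain `Theorems.ObstructionCalculus{Action,Invariants,Slots,PadInheritance,Locality}`
(`orbitVanishing`, `evalT`, `evalT_eq_zero_of_tensorRank_le`, `tensorRank_le_card_of_eq_finset_sum`, `padMM`).

**Theorem (rung R1, MM-free; Landsberg, GCT Prop. 8.3.4.1 — prolongation).** A polynomial of total degree `≤ m` on
`ℂ^m ⊗ ℂ^m ⊗ ℂ^m` vanishing on `GL_m³·⟨m⟩` is zero: each monomial involves `≤ m` coordinates, a tensor supported on `≤ m`
coordinates has rank `≤ m`, and `I(σ_m)` kills every tensor of rank `≤ m`.  Rung R2 (item 30921, `rankMethodsBlindPastCactus_of`)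
is NOT landed here: it needs `Literature.Barriers.MatrixMultiplication.LinearRankMethodBarrierProofs`, unbuilt on the farm
(probe rc 75 `unbuilt:…HankelRank`, 2026-08-30T11:3xZ).  Nothing here proves ω = 2.
-/

set_option linter.dupNamespace false
set_option autoImplicit false

noncomputable section

open scoped BigOperators
open Finset

namespace Summit.MatrixMultiplication.MatrixMultiplication.Theorems.ObstructionDescentFormatDegreeBlind

open Literature.Computability.AlgebraicComplexity (triad triad_apply tensorRank unitTensor unitTensor_apply)
open Summit.MatrixMultiplication.MatrixMultiplication.Theorems.ObstructionCalculus
open Summit.MatrixMultiplication.MatrixMultiplication.Theses.ObstructionDescent (FormatDegreeBlind)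

/-! ### Transport of the route item to the language of the calculus -/

/-- Structured reading of rung R1. [bookkeeping] -/
theorem formatDegreeBlind_iff : FormatDegreeBlind ↔
    ∀ (m : ℕ) (f : MvPolynomial (Idx m) ℂ), f.totalDegree ≤ m → f ∈ orbitVanishing (unitTensor ℂ m) → f = 0 :=
  Iff.rfl

/-! ### Rung R1 (kernel): equations of degree `≤ m` are blind — the `c = 1` row of `E` -/

/-- **A polynomial of total degree `≤ m` vanishing on `GL_m³·⟨m⟩` is zero** (not necessarily homogeneous;
the argument of `hwvSpace_eq_bot_of_degree_le` run monomial by monomial with `MvPolynomial.le_totalDegree`).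
[cite: LandsbergGCT2017, Prop. 8.3.4.1 (p. 227)] -/
theorem eq_zero_of_totalDegree_le {m : ℕ} {f : MvPolynomial (Idx m) ℂ} (hd : f.totalDegree ≤ m)
    (hfU : f ∈ orbitVanishing (unitTensor ℂ m)) : f = 0 := by
  classical
  ext μ
  rw [MvPolynomial.coeff_zero]
  by_contra hμ
  -- the monomial `μ` involves at most `deg μ ≤ deg f ≤ m` coordinates
  have hcardμ : μ.support.card ≤ m := by
    have hdeg : (μ.sum fun _ e => e) ≤ f.totalDegree :=
      MvPolynomial.le_totalDegree (MvPolynomial.mem_support_iff.2 hμ)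
    have hle : μ.support.card ≤ μ.sum fun _ e => e := by
      rw [Finsupp.sum, Finset.card_eq_sum_ones]
      exact Finset.sum_le_sum fun i hi => Nat.one_le_iff_ne_zero.2 (Finsupp.mem_support_iff.1 hi)
    exact hle.trans (hdeg.trans hd)
  -- the restriction `g` of `f` to the coordinate subspace `ℂ^P`, `P = supp μ`
  obtain ⟨P, hP⟩ : ∃ P : Finset (Idx m), P = μ.support := ⟨_, rfl⟩
  obtain ⟨φ, hφ⟩ : ∃ φ : Idx m → MvPolynomial (Idx m) ℂ,
      φ = fun p => if p ∈ P then MvPolynomial.X p else 0 := ⟨_, rfl⟩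
  -- `g` vanishes identically: its values are values of `f` at tensors of rank `≤ |P| ≤ m`
  have hg0 : MvPolynomial.aeval φ f = 0 := by
    apply MvPolynomial.funext
    intro v
    rw [map_zero, ← MvPolynomial.aeval_eq_eval, MvPolynomial.comp_aeval_apply]
    have hfun : (fun p => MvPolynomial.aeval v (φ p)) = fun p : Idx m =>
        (fun a b c => if (a, b, c) ∈ P then v (a, b, c) else 0) p.1 p.2.1 p.2.2 := by
      funext p
      obtain ⟨a, b, c⟩ := p
      rw [hφ]
      dsimp only
      split_ifs <;> simp
    rw [hfun]
    change evalT (fun a b c => if (a, b, c) ∈ P then v (a, b, c) else 0) f = 0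
    apply evalT_eq_zero_of_tensorRank_le hfU
    refine le_trans ?_ (hP ▸ hcardμ)
    refine tensorRank_le_card_of_eq_finset_sum P (fun p => Pi.single p.1 (v p))
      (fun p => Pi.single p.2.1 1) (fun p => Pi.single p.2.2 1) ?_
    funext a b c
    rw [Finset.sum_apply, Finset.sum_apply, Finset.sum_apply]
    have hterm : ∀ q ∈ P, triad (Pi.single q.1 (v q)) (Pi.single q.2.1 (1 : ℂ))
        (Pi.single q.2.2 (1 : ℂ)) a b c = if (a, b, c) = q then v (a, b, c) else 0 := by
      rintro ⟨i, j, k⟩ _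
      rw [triad_apply, Pi.single_apply, Pi.single_apply, Pi.single_apply]
      by_cases hi : a = i
      · subst hi
        by_cases hj : b = j
        · subst hj
          by_cases hk : c = k
          · subst hk
            simp
          · simp [hk]
        · simp [hj]
      · simp [hi]
    rw [Finset.sum_congr rfl hterm, Finset.sum_ite_eq]
  -- but the `μ`-coefficient of `g` is that of `f`
  have hsum : MvPolynomial.aeval φ f =
      ∑ ν ∈ f.support, MvPolynomial.aeval φ (MvPolynomial.monomial ν (MvPolynomial.coeff ν f)) := by
    conv_lhs => rw [f.as_sum]
    rw [map_sum]
  have hterm : ∀ ν ∈ f.support,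
      MvPolynomial.coeff μ (MvPolynomial.aeval φ (MvPolynomial.monomial ν (MvPolynomial.coeff ν f))) =
        if μ = ν then MvPolynomial.coeff μ f else 0 := by
    intro ν hν
    rw [MvPolynomial.aeval_monomial, MvPolynomial.algebraMap_eq]
    by_cases hsub : ν.support ⊆ P
    · have hprod : (ν.prod fun i k => φ i ^ k) = MvPolynomial.monomial ν (1 : ℂ) := by
        rw [MvPolynomial.monomial_eq, MvPolynomial.C_1, one_mul, Finsupp.prod, Finsupp.prod]
        exact Finset.prod_congr rfl fun i hi => by
          rw [hφ]
          dsimp only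
          rw [if_pos (hsub hi)]
      rw [hprod, MvPolynomial.C_mul_monomial, mul_one, MvPolynomial.coeff_monomial]
      by_cases hμν : ν = μ
      · subst hμν
        simp
      · rw [if_neg hμν, if_neg (Ne.symm hμν)]
    · obtain ⟨i, hiν, hiP⟩ := Finset.not_subset.1 hsub
      have hzero : (ν.prod fun i k => φ i ^ k) = 0 := by
        rw [Finsupp.prod]
        apply Finset.prod_eq_zero hiν
        rw [hφ]
        dsimp only
        rw [if_neg hiP, zero_pow (Finsupp.mem_support_iff.1 hiν)]
      rw [hzero, mul_zero, MvPolynomial.coeff_zero, if_neg]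
      rintro rfl
      exact hiP (hP ▸ hiν)
  have hcoeff : MvPolynomial.coeff μ (MvPolynomial.aeval φ f) = MvPolynomial.coeff μ f := by
    rw [hsum, MvPolynomial.coeff_sum, Finset.sum_congr rfl hterm, Finset.sum_ite_eq,
      if_pos (MvPolynomial.mem_support_iff.2 hμ)]
  rw [hg0, MvPolynomial.coeff_zero] at hcoeff
  exact hμ hcoeff.symm

/-- **Rung R1 holds** (kernel). [this node] -/
theorem formatDegreeBlind_holds : FormatDegreeBlind :=
  formatDegreeBlind_iff.2 fun _ _ hd hf => eq_zero_of_totalDegree_le hd hf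

/-- **The `c = 1` row of `E`, uniformly in `n`** (no scale hypothesis needed): an equation of `σ_m` of
degree `≤ m` vanishes on `GL_m³·pad_m⟨n,n,n⟩` — because it is `0`. [this node] -/
theorem noPolyDegreeObstruction_row_one {n m : ℕ} (h : n * n ≤ m) {f : MvPolynomial (Idx m) ℂ}
    (hd : f.totalDegree ≤ m ^ 1) (hf : f ∈ orbitVanishing (unitTensor ℂ m)) :
    f ∈ orbitVanishing (padMM ℂ n m h) := by
  rw [pow_one] at hd
  rw [eq_zero_of_totalDegree_le hd hf]
  exact Submodule.zero_mem _

/-- The `c = 1` row of `E` in the item's own quantifier shape. [this node] -/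
theorem noPolyDegreeObstruction_one (τ : ℝ) (_hτ : 2 < τ) :
    ∃ n₀ : ℕ, ∀ n m : ℕ, n₀ ≤ n → ∀ h : n * n ≤ m, (n : ℝ) ^ τ ≤ (m : ℝ) →
      ∀ f : MvPolynomial (Idx m) ℂ, f.totalDegree ≤ m ^ 1 →
        f ∈ orbitVanishing (unitTensor ℂ m) → f ∈ orbitVanishing (padMM ℂ n m h) :=
  ⟨0, fun _ _ _ h _ _ hd hf => noPolyDegreeObstruction_row_one h hd hf⟩

end Summit.MatrixMultiplication.MatrixMultiplication.Theorems.ObstructionDescentFormatDegreeBlind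

end
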